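import Summits.Ventures.YMGap.RobustBall.BoundaryFreeEnergyMixing
import Summits.Ventures.YMGap.RobustBall.BoundaryRelativeEntropy
import Literature.MathematicalPhysics.QuantumManyBody.PeriodicFeynmanKacDuhamel
import Summits.Ventures.YMGap.Thresholds.ZdSmoothingLipschitz
import Summits.Ventures.YMGap.Thresholds.CouplingDerivativeTools
import Summits.Ventures.YMGap.Thresholds.TorusStateResponse
import HarnessLib

/-!
# Venture YMGap, track ROBUST-BALL — «C-DS-II», the `SU(N)` currency: the boundary factors are bounded Lipschitz cylinders

HONEST FRAMING. WHAT THIS IS: a venture file (cell `pub-ymgap`, track Y2 ROBUST-BALL / DS, seat ds-3, theorems only, 0 compute), sequel of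
`BoundaryFreeEnergyMixing.lean` (the door of «C-DS-II»: mixed boundary differences of `log Z_Λ` = kernel covariances of boundary factors).
Here, for `G = SU(N)` (fundamental Wilson action, any `N`, any `d`, any real `b`, any finite `Λ`, boundary fields `η' = η` off `B`,
`P = {p ∈ T(Λ) : p ∩ B ≠ ∅}`):
* `abs_plaquetteObs_sub_le_dist` — `Re tr U_p` is `4N⁴`-Lipschitz in the entry tuple of
  its links; `dist_glueWith_plaquette_le`;
* `suN_abs_boundaryShift_le` — `|ΔS_{η→η'}| ≤ 2N·#P`; `suN_abs_boundaryShift_sub_le_dist` — `ΔS_{η→η'}` is `8N⁴#P`-Lipschitz in the inner links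
  of `P`;
* ★ `suN_isLipschitzCylinder_boundaryFactor` — `U ↦ exp(−bΔS_{η→η'}(U_Λ))` is a Lipschitz cylinder on the links of `P` with any constant
  `K ≥ |b|·e^{2N|b|#P}·8N⁴#P` — the currency of the seat's kernel-clustering rows (`KernelClusteringBall`, `StarKernelClusteringZd`), whose
  `SU(2)` cells turn the door into the Dobrushin–Shlosman Condition-II shape with explicit rates.
* ★ `abs_log_normaliser_sub_log_normaliser_le_of_bound` (every compact `G`) / `suN_abs_log_normaliser_sub_log_normaliser_le` — at EVERY coupling,
  changing the boundary field on `B` moves `log Z_Λ(b|·)` by at most `|b| · 2N · #P` (pure surface bound, no window, no clustering).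
* ★ `suN_klDiv_inner_law_le` — at EVERY coupling the inner-link laws under two boundary fields differing on `B` have relative entropy
  `≤ |b| · 4N · #P` («C-ENT-BC» cell, via `BoundaryRelativeEntropy.klDiv_inner_law_le`).
WHAT THIS IS NOT: no clustering proved here; lattice bookkeeping only; nothing continuum / Clay. Everything here is proved. [folklore]
-/

noncomputable section

open MeasureTheory ProbabilityTheory Filter Topology Real Finset Set
open scoped NNReal
open Literature.Probability.LatticeModels hiding configShift configShift_apply
open Literature.MathematicalPhysics.QuantumLattice
open Literature.MathematicalPhysics.QuantumFieldTheory (IsLipschitzCylinder isLipschitzCylinder_zdPlaquetteObs zdPlaquetteObs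
  haarProbability card_plaquetteEdges_le suEntries)

namespace Summit.Ventures.YMGap.RobustBall

namespace BoundaryFreeEnergy

/-! ### Part C — `SU(N)`: bounds and Lipschitz-cylinder certificates of the boundary factors (the currency of the clustering rows) -/

section SUN

variable {d N : ℕ}

open Summit.Ventures.YMGap.CouplingResponse (plaquetteObs_fundamentalRep_eq_mul_zdPlaquetteObs)
open Summit.Ventures.YMGap.ZdSmoothing (isLipschitzCylinder_of_dist_le)

/-- **Plaquette observables are `4N⁴`-Lipschitz in the entry tuple of their four links** (`Re tr = N · W̄`, `W̄` the tree's `4N³`-Lipschitz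
cylinder `zdPlaquetteObs`). [folklore] -/
theorem abs_plaquetteObs_sub_le_dist (p : ZdPlaquette d) (X Y : LGConfig d (Matrix.specialUnitaryGroup (Fin N) ℂ)) :
    |plaquetteObs (fundamentalRep (Fin N)) p.1 p.2.1.1 p.2.1.2 X - plaquetteObs (fundamentalRep (Fin N)) p.1 p.2.1.1 p.2.1.2 Y| ≤
      4 * (N : ℝ) ^ 4 * dist (fun e : ↥(plaquetteEdges p) => suEntries (X e)) (fun e : ↥(plaquetteEdges p) => suEntries (Y e)) := by
  obtain ⟨x, ⟨⟨i, j⟩, hij⟩⟩ := p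
  obtain ⟨f, hf, hF⟩ := (isLipschitzCylinder_zdPlaquetteObs (d := d) (N := N) x hij).exists_suEntries
  have h1 := hf.dist_le_mul (fun e : ↥(plaquetteEdges ((x, ⟨(i, j), hij⟩) : ZdPlaquette d)) => suEntries (X e))
    (fun e => suEntries (Y e))
  rw [← hF X, ← hF Y, Real.dist_eq] at h1
  dsimp only
  rw [plaquetteObs_fundamentalRep_eq_mul_zdPlaquetteObs, plaquetteObs_fundamentalRep_eq_mul_zdPlaquetteObs, ← mul_sub, abs_mul,
    Nat.abs_cast]
  have hN : (0 : ℝ) ≤ N := Nat.cast_nonneg N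
  calc (N : ℝ) * |zdPlaquetteObs (fundamentalRep (Fin N)) x i j X - zdPlaquetteObs (fundamentalRep (Fin N)) x i j Y|
      ≤ N * (((4 * (N : ℝ≥0) ^ 3 : ℝ≥0) : ℝ) *
          dist (fun e : ↥(plaquetteEdges ((x, ⟨(i, j), hij⟩) : ZdPlaquette d)) => suEntries (X e)) (fun e => suEntries (Y e))) :=
        mul_le_mul_of_nonneg_left h1 hN
    _ = 4 * (N : ℝ) ^ 4 * dist (fun e : ↥(plaquetteEdges ((x, ⟨(i, j), hij⟩) : ZdPlaquette d)) => suEntries (X e))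
          (fun e => suEntries (Y e)) := by push_cast; ring

/-- Gluing two inner configurations to the SAME outer field: on the links of a plaquette contained in `Δ`, the entry tuples are no farther
apart than the inner tuples over `Δ`. [folklore] -/
theorem dist_glueWith_plaquette_le {Λ Δ : Finset (ZdEdge d)} {p : ZdPlaquette d} (hp : plaquetteEdges p ⊆ Δ)
    (ω U V : LGConfig d (Matrix.specialUnitaryGroup (Fin N) ℂ)) :
    dist (fun e : ↥(plaquetteEdges p) => suEntries (glueWith Λ (fun e : ↥Λ => U e) ω e))
        (fun e : ↥(plaquetteEdges p) => suEntries (glueWith Λ (fun e : ↥Λ => V e) ω e)) ≤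
      dist (fun e : ↥Δ => suEntries (U e)) (fun e : ↥Δ => suEntries (V e)) := by
  refine (dist_pi_le_iff dist_nonneg).2 fun e => ?_
  by_cases he : (e : ZdEdge d) ∈ Λ
  · rw [glueWith_apply_mem _ _ _ he, glueWith_apply_mem _ _ _ he]
    exact dist_le_pi_dist (fun e : ↥Δ => suEntries (U e)) (fun e : ↥Δ => suEntries (V e)) ⟨e.1, hp e.2⟩
  · rw [glueWith_apply_not_mem _ _ _ he, glueWith_apply_not_mem _ _ _ he, dist_self]
    exact dist_nonneg

/-- **`SU(N)`: the boundary shift is bounded by `2N` per plaquette touching the modification set**: if `η' = η` off `B`, then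
`|S_Λ(ζ ⊕ η') − S_Λ(ζ ⊕ η)| ≤ 2N · #{p ∈ T(Λ) : p ∩ B ≠ ∅}`. [folklore] -/
theorem suN_abs_boundaryShift_le [DecidableEq (ZdEdge d)] (Λ B : Finset (ZdEdge d))
    {η η' : LGConfig d (Matrix.specialUnitaryGroup (Fin N) ℂ)} (hη' : ∀ e, e ∉ B → η' e = η e) (ζ : ↥Λ → Matrix.specialUnitaryGroup (Fin N) ℂ) :
    |wilsonBoundaryAction (fundamentalRep (Fin N)) Λ (glueWith Λ ζ η') - wilsonBoundaryAction (fundamentalRep (Fin N)) Λ (glueWith Λ ζ η)| ≤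
      2 * N * ((plaquettesTouching Λ).filter (fun p => (plaquetteEdges p ∩ B).Nonempty)).card := by
  rw [boundaryShift_eq_sum_filter (fundamentalRep (Fin N)) Λ B hη' ζ]
  refine (Finset.abs_sum_le_sum_abs _ _).trans ?_
  refine (Finset.sum_le_card_nsmul _ _ (2 * (N : ℝ)) fun p _ => ?_).trans (by rw [nsmul_eq_mul]; ring_nf; rfl)
  have h1 := abs_plaquetteObs_le_holds (fundamentalRep (Fin N)) fundamentalRep_mem_unitaryGroup p.1 p.2.1.1 p.2.1.2 (glueWith Λ ζ η)
  have h2 := abs_plaquetteObs_le_holds (fundamentalRep (Fin N)) fundamentalRep_mem_unitaryGroup p.1 p.2.1.1 p.2.1.2 (glueWith Λ ζ η')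
  calc |plaquetteObs (fundamentalRep (Fin N)) p.1 p.2.1.1 p.2.1.2 (glueWith Λ ζ η) -
        plaquetteObs (fundamentalRep (Fin N)) p.1 p.2.1.1 p.2.1.2 (glueWith Λ ζ η')|
      ≤ |plaquetteObs (fundamentalRep (Fin N)) p.1 p.2.1.1 p.2.1.2 (glueWith Λ ζ η)| +
          |plaquetteObs (fundamentalRep (Fin N)) p.1 p.2.1.1 p.2.1.2 (glueWith Λ ζ η')| := abs_sub _ _
    _ ≤ N + N := add_le_add h1 h2
    _ = 2 * N := by ring

/-- **`SU(N)`: the boundary shift is Lipschitz in the inner links**, constant `8N⁴` per plaquette touching the modification set, for the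
entry tuple over the links of those plaquettes. [folklore] -/
theorem suN_abs_boundaryShift_sub_le_dist [DecidableEq (ZdEdge d)] (Λ B : Finset (ZdEdge d))
    {η η' : LGConfig d (Matrix.specialUnitaryGroup (Fin N) ℂ)} (hη' : ∀ e, e ∉ B → η' e = η e)
    (U V : LGConfig d (Matrix.specialUnitaryGroup (Fin N) ℂ)) :
    |(wilsonBoundaryAction (fundamentalRep (Fin N)) Λ (glueWith Λ (fun e : ↥Λ => U e) η') -
          wilsonBoundaryAction (fundamentalRep (Fin N)) Λ (glueWith Λ (fun e : ↥Λ => U e) η)) -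
        (wilsonBoundaryAction (fundamentalRep (Fin N)) Λ (glueWith Λ (fun e : ↥Λ => V e) η') -
          wilsonBoundaryAction (fundamentalRep (Fin N)) Λ (glueWith Λ (fun e : ↥Λ => V e) η))| ≤
      8 * (N : ℝ) ^ 4 * ((plaquettesTouching Λ).filter (fun p => (plaquetteEdges p ∩ B).Nonempty)).card *
        dist (fun e : ↥(((plaquettesTouching Λ).filter (fun p => (plaquetteEdges p ∩ B).Nonempty)).biUnion plaquetteEdges) =>
            suEntries (U e))
          (fun e => suEntries (V e)) := by
  set P := (plaquettesTouching Λ).filter (fun p => (plaquetteEdges p ∩ B).Nonempty) with hP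
  set Δ := P.biUnion plaquetteEdges with hΔ
  set δ := dist (fun e : ↥Δ => suEntries (U e)) (fun e : ↥Δ => suEntries (V e)) with hδ
  rw [boundaryShift_eq_sum_filter (fundamentalRep (Fin N)) Λ B hη' (fun e : ↥Λ => U e),
    boundaryShift_eq_sum_filter (fundamentalRep (Fin N)) Λ B hη' (fun e : ↥Λ => V e), ← Finset.sum_sub_distrib]
  refine (Finset.abs_sum_le_sum_abs _ _).trans ?_
  refine (Finset.sum_le_card_nsmul _ _ (8 * (N : ℝ) ^ 4 * δ) fun p hp => ?_).trans
    (by rw [nsmul_eq_mul, ← hP]; exact le_of_eq (by ring))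
  have hpΔ : plaquetteEdges p ⊆ Δ := Finset.subset_biUnion_of_mem plaquetteEdges hp
  have hA := abs_plaquetteObs_sub_le_dist (N := N) p (glueWith Λ (fun e : ↥Λ => U e) η) (glueWith Λ (fun e : ↥Λ => V e) η)
  have hB := abs_plaquetteObs_sub_le_dist (N := N) p (glueWith Λ (fun e : ↥Λ => U e) η') (glueWith Λ (fun e : ↥Λ => V e) η')
  have hdA := dist_glueWith_plaquette_le (Λ := Λ) hpΔ η U V
  have hdB := dist_glueWith_plaquette_le (Λ := Λ) hpΔ η' U V
  have hN4 : (0 : ℝ) ≤ 4 * (N : ℝ) ^ 4 := by positivity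
  rw [show ∀ a b c e : ℝ, (a - b) - (c - e) = (a - c) - (b - e) from fun a b c e => by ring]
  calc |plaquetteObs (fundamentalRep (Fin N)) p.1 p.2.1.1 p.2.1.2 (glueWith Λ (fun e : ↥Λ => U e) η) -
          plaquetteObs (fundamentalRep (Fin N)) p.1 p.2.1.1 p.2.1.2 (glueWith Λ (fun e : ↥Λ => V e) η) -
        (plaquetteObs (fundamentalRep (Fin N)) p.1 p.2.1.1 p.2.1.2 (glueWith Λ (fun e : ↥Λ => U e) η') -
          plaquetteObs (fundamentalRep (Fin N)) p.1 p.2.1.1 p.2.1.2 (glueWith Λ (fun e : ↥Λ => V e) η'))|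
      ≤ |plaquetteObs (fundamentalRep (Fin N)) p.1 p.2.1.1 p.2.1.2 (glueWith Λ (fun e : ↥Λ => U e) η) -
            plaquetteObs (fundamentalRep (Fin N)) p.1 p.2.1.1 p.2.1.2 (glueWith Λ (fun e : ↥Λ => V e) η)| +
          |plaquetteObs (fundamentalRep (Fin N)) p.1 p.2.1.1 p.2.1.2 (glueWith Λ (fun e : ↥Λ => U e) η') -
            plaquetteObs (fundamentalRep (Fin N)) p.1 p.2.1.1 p.2.1.2 (glueWith Λ (fun e : ↥Λ => V e) η')| := abs_sub _ _
    _ ≤ 4 * (N : ℝ) ^ 4 * δ + 4 * (N : ℝ) ^ 4 * δ :=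
        add_le_add (hA.trans (mul_le_mul_of_nonneg_left hdA hN4)) (hB.trans (mul_le_mul_of_nonneg_left hdB hN4))
    _ = 8 * (N : ℝ) ^ 4 * δ := by ring

/-- ★ **`SU(N)`: THE BOUNDARY FACTOR IS A LIPSCHITZ CYLINDER** — the currency in which the kernel-clustering rows are fed. If `η' = η` off `B`
and `P = {p ∈ T(Λ) : p ∩ B ≠ ∅}`, then `U ↦ exp(−b (S_Λ(U_Λ ⊕ η') − S_Λ(U_Λ ⊕ η)))` is a Lipschitz cylinder on the links of `P` with any constant
`K ≥ |b| · e^{2N|b|·#P} · 8N⁴ · #P`. [folklore] -/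
theorem suN_isLipschitzCylinder_boundaryFactor [DecidableEq (ZdEdge d)] (b : ℝ) (Λ B : Finset (ZdEdge d))
    {η η' : LGConfig d (Matrix.specialUnitaryGroup (Fin N) ℂ)} (hη' : ∀ e, e ∉ B → η' e = η e) {K : ℝ≥0}
    (hK : |b| * Real.exp (|b| * (2 * N * ((plaquettesTouching Λ).filter (fun p => (plaquetteEdges p ∩ B).Nonempty)).card)) *
      (8 * (N : ℝ) ^ 4 * ((plaquettesTouching Λ).filter (fun p => (plaquetteEdges p ∩ B).Nonempty)).card) ≤ K) :
    IsLipschitzCylinder (fundamentalRep (Fin N))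
      (fun U : LGConfig d (Matrix.specialUnitaryGroup (Fin N) ℂ) =>
        Real.exp (-b * (wilsonBoundaryAction (fundamentalRep (Fin N)) Λ (glueWith Λ (fun e : ↥Λ => U e) η') -
          wilsonBoundaryAction (fundamentalRep (Fin N)) Λ (glueWith Λ (fun e : ↥Λ => U e) η))))
      (((plaquettesTouching Λ).filter (fun p => (plaquetteEdges p ∩ B).Nonempty)).biUnion plaquetteEdges) K := by
  set P := (plaquettesTouching Λ).filter (fun p => (plaquetteEdges p ∩ B).Nonempty) with hP
  set c : ℝ := 2 * N * P.card with hc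
  refine isLipschitzCylinder_of_dist_le fun U V => ?_
  set δ := dist (fun e : ↥(P.biUnion plaquetteEdges) => suEntries (U e)) (fun e => suEntries (V e)) with hδ
  set x : ℝ := -b * (wilsonBoundaryAction (fundamentalRep (Fin N)) Λ (glueWith Λ (fun e : ↥Λ => U e) η') -
    wilsonBoundaryAction (fundamentalRep (Fin N)) Λ (glueWith Λ (fun e : ↥Λ => U e) η)) with hx
  set y : ℝ := -b * (wilsonBoundaryAction (fundamentalRep (Fin N)) Λ (glueWith Λ (fun e : ↥Λ => V e) η') -
    wilsonBoundaryAction (fundamentalRep (Fin N)) Λ (glueWith Λ (fun e : ↥Λ => V e) η)) with hy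
  have hxb : |x| ≤ |b| * c := by
    rw [hx, abs_mul, abs_neg]; exact mul_le_mul_of_nonneg_left (suN_abs_boundaryShift_le Λ B hη' _) (abs_nonneg b)
  have hyb : |y| ≤ |b| * c := by
    rw [hy, abs_mul, abs_neg]; exact mul_le_mul_of_nonneg_left (suN_abs_boundaryShift_le Λ B hη' _) (abs_nonneg b)
  have hmax : max x y ≤ |b| * c := max_le ((le_abs_self x).trans hxb) ((le_abs_self y).trans hyb)
  have hxy : |x - y| ≤ |b| * (8 * (N : ℝ) ^ 4 * P.card * δ) := by
    rw [hx, hy, ← mul_sub, abs_mul, abs_neg]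
    exact mul_le_mul_of_nonneg_left (suN_abs_boundaryShift_sub_le_dist Λ B hη' U V) (abs_nonneg b)
  have hδ0 : 0 ≤ δ := dist_nonneg
  calc |Real.exp x - Real.exp y| ≤ Real.exp (max x y) * |x - y| :=
        Literature.MathematicalPhysics.QuantumManyBody.BoseGas.abs_exp_sub_exp_le_exp_max_mul x y
    _ ≤ Real.exp (|b| * c) * (|b| * (8 * (N : ℝ) ^ 4 * P.card * δ)) :=
        mul_le_mul (Real.exp_le_exp.2 hmax) hxy (abs_nonneg _) (Real.exp_pos _).le
    _ = (|b| * Real.exp (|b| * c) * (8 * (N : ℝ) ^ 4 * P.card)) * δ := by ring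
    _ ≤ K * δ := mul_le_mul_of_nonneg_right hK hδ0

end SUN

/-! ### All couplings: a boundary field changes the free energy by at most `|b|` times the boundary shift -/

section AllCouplings

variable {d N : ℕ} {G : Type*} [Group G] [TopologicalSpace G] [IsTopologicalGroup G] [CompactSpace G]
  [MeasurableSpace G] [BorelSpace G] [SecondCountableTopology G] (ρ : G →* Matrix (Fin N) (Fin N) ℂ)

/-- **At EVERY coupling, for every compact `G`: a bounded boundary shift moves the free energy by at most `|b|·D`.** If
`|S_Λ(ζ ⊕ η') − S_Λ(ζ ⊕ η)| ≤ D` for all inner configurations `ζ`, then `|log Z_Λ(b|η') − log Z_Λ(b|η)| ≤ |b| D` (the ratio of normalisers is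
the kernel expectation of `exp(−bΔS) ∈ [e^{−|b|D}, e^{|b|D}]`). No window, no clustering. [folklore] -/
theorem abs_log_normaliser_sub_log_normaliser_le_of_bound (hρ : Continuous ρ) (b : ℝ) (Λ : Finset (ZdEdge d)) {η η' : LGConfig d G}
    {D : ℝ} (hD : ∀ ζ : ↥Λ → G, |wilsonBoundaryAction ρ Λ (glueWith Λ ζ η') - wilsonBoundaryAction ρ Λ (glueWith Λ ζ η)| ≤ D) :
    |Real.log (∫ ζ, Real.exp (-b * wilsonBoundaryAction ρ Λ (glueWith Λ ζ η')) ∂(Measure.pi fun _ : ↥Λ => haarProbability G)) -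
        Real.log (∫ ζ, Real.exp (-b * wilsonBoundaryAction ρ Λ (glueWith Λ ζ η)) ∂(Measure.pi fun _ : ↥Λ => haarProbability G))| ≤
      |b| * D := by
  haveI := isProbabilityMeasure_ymSpecification ρ hρ b Λ η
  rw [log_normaliser_sub_eq_log_integral ρ hρ b Λ η η']
  set F : LGConfig d G → ℝ := fun U => Real.exp (-b * (wilsonBoundaryAction ρ Λ (glueWith Λ (fun e : ↥Λ => U e) η') -
    wilsonBoundaryAction ρ Λ (glueWith Λ (fun e : ↥Λ => U e) η))) with hF
  have hS : Continuous (wilsonBoundaryAction (G := G) ρ Λ) := continuous_wilsonBoundaryAction ρ hρ Λ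
  have hR : ∀ ω : LGConfig d G, Measurable fun U : LGConfig d G => glueWith Λ (fun e : ↥Λ => U e) ω := fun ω =>
    Measurable.comp (g := fun ζ : ↥Λ → G => glueWith Λ ζ ω) (f := fun U : LGConfig d G => fun e : ↥Λ => U e)
      (measurable_glueWith Λ ω) (measurable_pi_lambda _ fun e => measurable_pi_apply (e : ZdEdge d))
  have hFm : Measurable F :=
    Real.measurable_exp.comp (((hS.measurable.comp (hR η')).sub (hS.measurable.comp (hR η))).const_mul _)
  have hbd : ∀ U, Real.exp (-(|b| * D)) ≤ F U ∧ F U ≤ Real.exp (|b| * D) := fun U => by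
    have h := hD (fun e : ↥Λ => U e)
    have hx : |-b * (wilsonBoundaryAction ρ Λ (glueWith Λ (fun e : ↥Λ => U e) η') -
        wilsonBoundaryAction ρ Λ (glueWith Λ (fun e : ↥Λ => U e) η))| ≤ |b| * D := by
      rw [abs_mul, abs_neg]; exact mul_le_mul_of_nonneg_left h (abs_nonneg b)
    exact ⟨Real.exp_le_exp.2 (by linarith [neg_abs_le (-b * (wilsonBoundaryAction ρ Λ (glueWith Λ (fun e : ↥Λ => U e) η') -
        wilsonBoundaryAction ρ Λ (glueWith Λ (fun e : ↥Λ => U e) η)))]), Real.exp_le_exp.2 ((le_abs_self _).trans hx)⟩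
  have hFb : ∀ U, |F U| ≤ Real.exp (|b| * D) := fun U =>
    abs_le.2 ⟨by linarith [(hbd U).1, Real.exp_pos (-(|b| * D)), Real.exp_pos (|b| * D)], (hbd U).2⟩
  have hFi : Integrable F (ymSpecification ρ b Λ η) := integrable_of_bound hFm.aestronglyMeasurable hFb
  have hlo : Real.exp (-(|b| * D)) ≤ ∫ U, F U ∂(ymSpecification ρ b Λ η) := by
    have h := integral_mono (integrable_const (Real.exp (-(|b| * D)))) hFi fun U => (hbd U).1
    simpa using h
  have hhi : (∫ U, F U ∂(ymSpecification ρ b Λ η)) ≤ Real.exp (|b| * D) := by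
    have h := integral_mono hFi (integrable_const (Real.exp (|b| * D))) fun U => (hbd U).2
    simpa using h
  have hpos : 0 < ∫ U, F U ∂(ymSpecification ρ b Λ η) := (Real.exp_pos _).trans_le hlo
  rw [abs_le]
  constructor
  · have h := Real.log_le_log (Real.exp_pos _) hlo
    rw [Real.log_exp] at h
    linarith
  · have h := Real.log_le_log hpos hhi
    rw [Real.log_exp] at h
    exact h

end AllCouplings

/-- ★ **`SU(N)`, EVERY coupling, every `d`, every finite `Λ`: changing the boundary field on `B` moves `log Z_Λ(b|·)` by at most
`|b| · 2N · #{p ∈ T(Λ) : p ∩ B ≠ ∅}`** — a pure SURFACE bound with no window and no clustering (the complement of «C-DS-I», which identifies the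
volume term on the strong-coupling window). [folklore] -/
theorem suN_abs_log_normaliser_sub_log_normaliser_le {d N : ℕ} [DecidableEq (ZdEdge d)] (b : ℝ) (Λ B : Finset (ZdEdge d))
    {η η' : LGConfig d (Matrix.specialUnitaryGroup (Fin N) ℂ)} (hη' : ∀ e, e ∉ B → η' e = η e) :
    |Real.log (∫ ζ, Real.exp (-b * wilsonBoundaryAction (fundamentalRep (Fin N)) Λ (glueWith Λ ζ η'))
          ∂(Measure.pi fun _ : ↥Λ => haarProbability (Matrix.specialUnitaryGroup (Fin N) ℂ))) -
        Real.log (∫ ζ, Real.exp (-b * wilsonBoundaryAction (fundamentalRep (Fin N)) Λ (glueWith Λ ζ η))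
          ∂(Measure.pi fun _ : ↥Λ => haarProbability (Matrix.specialUnitaryGroup (Fin N) ℂ)))| ≤
      |b| * (2 * N * ((plaquettesTouching Λ).filter (fun p => (plaquetteEdges p ∩ B).Nonempty)).card) := by
  haveI : SecondCountableTopology (Matrix.specialUnitaryGroup (Fin N) ℂ) :=
    haveI : SecondCountableTopology (Matrix (Fin N) (Fin N) ℂ) := inferInstanceAs (SecondCountableTopology (Fin N → Fin N → ℂ))
    Topology.IsEmbedding.subtypeVal.secondCountableTopology
  exact abs_log_normaliser_sub_log_normaliser_le_of_bound (fundamentalRep (Fin N)) (continuous_fundamentalRep (Fin N)) b Λ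
    fun ζ => suN_abs_boundaryShift_le Λ B hη' ζ

/-- ★ **`SU(N)`, EVERY coupling: two boundary fields differing on `B` cost at most `|b| · 4N · #{p ∈ T(Λ) : p ∩ B ≠ ∅}` in relative entropy** of
the inner-link laws of the two DLR kernels (`klDiv_inner_law_le` with the `SU(N)` shift bound) — a pure SURFACE cost, so the relative entropy
per plaquette of two boundary conditions vanishes in the thermodynamic limit. [folklore] -/
theorem suN_klDiv_inner_law_le {d N : ℕ} [DecidableEq (ZdEdge d)] (b : ℝ) (Λ B : Finset (ZdEdge d))
    {η η' : LGConfig d (Matrix.specialUnitaryGroup (Fin N) ℂ)} (hη' : ∀ e, e ∉ B → η' e = η e) :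
    InformationTheory.klDiv
        ((Measure.pi fun _ : ↥Λ => haarProbability (Matrix.specialUnitaryGroup (Fin N) ℂ)).tilted
          (fun ζ => -b * wilsonBoundaryAction (fundamentalRep (Fin N)) Λ (glueWith Λ ζ η)))
        ((Measure.pi fun _ : ↥Λ => haarProbability (Matrix.specialUnitaryGroup (Fin N) ℂ)).tilted
          (fun ζ => -b * wilsonBoundaryAction (fundamentalRep (Fin N)) Λ (glueWith Λ ζ η'))) ≤
      ENNReal.ofReal (2 * |b| * (2 * N * ((plaquettesTouching Λ).filter (fun p => (plaquetteEdges p ∩ B).Nonempty)).card)) := by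
  haveI : SecondCountableTopology (Matrix.specialUnitaryGroup (Fin N) ℂ) :=
    haveI : SecondCountableTopology (Matrix (Fin N) (Fin N) ℂ) := inferInstanceAs (SecondCountableTopology (Fin N → Fin N → ℂ))
    Topology.IsEmbedding.subtypeVal.secondCountableTopology
  exact klDiv_inner_law_le (fundamentalRep (Fin N)) (continuous_fundamentalRep (Fin N)) b Λ fun ζ => suN_abs_boundaryShift_le Λ B hη' ζ

end BoundaryFreeEnergy

end Summit.Ventures.YMGap.RobustBall

end
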